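import Summits.BirchSwinnertonDyer.Rank1Residual.GaloisImage.KolyvaginTransferCocycle
import HarnessLib

/-!
# Transport of the Kolyvagin congruence through the derivative operator `D_r` — file G3 of
# THEOREM C of row T-DER (cell `b2b-bsdres`, team n1011, seat p11 GEN 9, OWNERS row T-DER =
# skel/T-DER.md STATUS v8 (v8-2), referee-1 GEN 35 ACK-1)

HONEST FRAMING (cell `b2b-bsdres`, run/shared/lean/b2b/bsd-rank1-residual/, verbatim in every
file): the goal of the cell is to DELETE the COMBINATION-SHAPED residual classes of the
Birch–Swinnerton-Dyer formula for ALL analytic-rank `≤ 1` elliptic curves over `ℚ` — "full BSD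
formula for every rank `≤ 1` curve in class `C`" assembled STRICTLY from published theorems — so
that the rank-`≤ 1` remainder becomes exactly the CONSTRUCTION-SHAPED classes, which are TYPED
(missing-input `Prop`s), NOT attempted. This is not "finishing BSD". Team n1011: research route on
the CONSTRUCTION-SHAPED class X4 / §I N11 (route-1 PORT, (P-DER)); TOOL theorems of continuous
group cohomology (no definition, no named fact, no `sorry`); curve-free, `p`-free.

## What

THEOREM C's assembly (file G2 `Derivative.apply_eq_aeval_apply_of_congruence`) consumes the
Kolyvagin congruence `x(φ) − Z x_r(φ) ∈ (φ − 1)T` for representatives `x`, `x_r` of the DERIVED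
classes `D_r c_{rq} ∈ H¹(F(rq), T)`, `D_r c_r ∈ H¹(F(r), T)`, whereas the Euler system delivers it
([PerrinRiou98] Prop. 2.2.5 (ii), files C0a–C0d) for the classes `c_{rq}`, `c_r` themselves — at
every prime `λ ∣ q`, i.e. at every conjugate datum `(w⁻¹φw, w⁻¹Zw)`.  This file transports the
congruence through `D_r = ∏_{ℓ ∈ r} Σ_{j<N_ℓ} j·(σ_ℓ^j ·)` (`Finset.noncommProd`, F3b/F4's shape).

§1 (cocycles; `Y` a topological representation of `G`, `N ≤ N'` normal subgroups, `S` ANY family of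
data `(φ, Z)` — a bound predicate, not a definition — stable under conjugation
`(φ, Z) ↦ (w⁻¹φw, ρ(w)⁻¹ Z ρ(w))` and with `Z` commuting with `ρ(φ)`).  The congruence property of a
pair of classes `(ξ₁, ξ₀) ∈ H¹(N, Y) × H¹(N', Y)`,
  `CONG_S(ξ₁, ξ₀)`: for all `(φ, Z) ∈ S` with `φ ∈ N` and ALL representatives `x₁`, `x₀`:
  `∃ t, x₁(φ) − Z x₀(φ) = φ t − t`,
is preserved by `(conjMap w, conjMap w)` (`cong_conjMap`: the representative `w⁻¹·x` and C0c's
`rho_apply_rho_conj_sub`), by sums (`cong_add`) and holds for `(0, 0)` (`cong_zero`).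
§2 (abstract; any relation `C` between two `A`-modules with these three closure properties with
respect to two commuting families of "conjugation" operators `E ℓ`, `E' ℓ`): `C` is preserved by
`ℕ`-multiples, powers `(E ℓ)^j`, the derivative operators `Σ_{j<N_ℓ} j (E ℓ)^j`, and their
`noncommProd` over `r` (`rel_noncommProd_deriv`) — so **`CONG_S(c_{rq}, c_r) ⇒ CONG_S(D_r c_{rq},
D_r c_r)`** (`cong_noncommProd_deriv`).  0 defs, 0 facts.

References: B. Perrin-Riou, Ann. Inst. Fourier 48 (1998), Prop. 2.2.5 (ii) (all `λ ∣ l`);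
K. Rubin, *Euler Systems* (2000), §4.4 (Def. 4.4.1 `D_r`), Cor. 4.8.1.
-/

noncomputable section

open CategoryTheory Function Finset
open Literature.NumberTheory.GaloisRepresentations
open Literature.NumberTheory.EllipticCurves (subgroupInclusion subgroupInclusion_apply_coe
  subgroupConj subgroupConj_apply_coe subgroupConj_one)

universe u v

namespace Summit.BirchSwinnertonDyer.Rank1Residual.GaloisImage

namespace Congruence

/-! ### §1 The congruence property of a pair of classes and its three closure properties -/

section Cocycles

variable {R : Type v} [CommRing R] [TopologicalSpace R]
variable {G : Type u} [Group G] [TopologicalSpace G] [IsTopologicalGroup G]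
variable (Y : TopRep.{u} R G) (N N' : Subgroup G) [N.Normal] [N'.Normal] (hNN' : N ≤ N')
variable (S : G → (Y →ₗ[R] Y) → Prop)

/-- A representative of `w · ξ` conjugated back by `w⁻¹` represents `ξ`. [folklore] -/
theorem oneCocycleClass_conj_inv_eq {H : Subgroup G} [H.Normal] (w : G)
    (ξ : continuousCohomology 1 (subgroupRep Y H)) (x : contOneCocycles (subgroupRep Y H))
    (hx : oneCocycleClass _ x = conjMap Y H w 1 ξ) :
    oneCocycleClass _ (contOneCocycles.pullback (subgroupConj H w⁻¹) (conjRepHom Y H w⁻¹) x) = ξ := by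
  rw [← conjMap_oneCocycleClass, hx, conjMap_conjMap, inv_mul_cancel, conjMap_one_one]

/-- Values of the back-conjugated representative: `(w⁻¹ · x)(w⁻¹ φ w) = w⁻¹ x(φ)`. [folklore] -/
theorem conj_inv_pullback_apply_conj {H : Subgroup G} [H.Normal] (w φ : G) (hφ : φ ∈ H)
    (hφw : w⁻¹ * φ * w ∈ H) (x : contOneCocycles (subgroupRep Y H)) :
    (contOneCocycles.pullback (subgroupConj H w⁻¹) (conjRepHom Y H w⁻¹) x).1 ⟨w⁻¹ * φ * w, hφw⟩ =
      Y.ρ w⁻¹ (x.1 ⟨φ, hφ⟩) := by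
  rw [conj_pullback_apply]
  congr 2
  exact Subtype.ext (by simp only [subgroupConj_apply_coe, inv_inv]; group)

/-- **`CONG_S` is preserved by conjugation** `(ξ₁, ξ₀) ↦ (w·ξ₁, w·ξ₀)`: a representative `x` of
`w·ξ` is `w·(w⁻¹·x)` with `w⁻¹·x` representing `ξ`; the congruence for `(w⁻¹·x₁, w⁻¹·x₀)` at the
conjugate datum `(w⁻¹φw, ρ(w)⁻¹Zρ(w)) ∈ S` is carried back by `ρ(w)` (C0c `rho_apply_rho_conj_sub`).
[cite: PerrinRiou1998AIF, Prop. 2.2.5 (ii)] -/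
theorem cong_conjMap
    (hSconj : ∀ φ (Z : Y →ₗ[R] Y) (w : G), S φ Z →
      S (w⁻¹ * φ * w) (((Y.ρ w⁻¹ : Y →L[R] Y) : Y →ₗ[R] Y) ∘ₗ Z ∘ₗ ((Y.ρ w : Y →L[R] Y) : Y →ₗ[R] Y)))
    (ξ₁ : continuousCohomology 1 (subgroupRep Y N)) (ξ₀ : continuousCohomology 1 (subgroupRep Y N'))
    (h : ∀ (φ : G) (hφ : φ ∈ N) (Z : Y →ₗ[R] Y), S φ Z →
      ∀ (x₁ : contOneCocycles (subgroupRep Y N)) (x₀ : contOneCocycles (subgroupRep Y N')),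
        oneCocycleClass _ x₁ = ξ₁ → oneCocycleClass _ x₀ = ξ₀ →
          ∃ t : Y, x₁.1 ⟨φ, hφ⟩ - Z (x₀.1 ⟨φ, hNN' hφ⟩) = Y.ρ φ t - t)
    (w : G) :
    ∀ (φ : G) (hφ : φ ∈ N) (Z : Y →ₗ[R] Y), S φ Z →
      ∀ (x₁ : contOneCocycles (subgroupRep Y N)) (x₀ : contOneCocycles (subgroupRep Y N')),
        oneCocycleClass _ x₁ = conjMap Y N w 1 ξ₁ → oneCocycleClass _ x₀ = conjMap Y N' w 1 ξ₀ →
          ∃ t : Y, x₁.1 ⟨φ, hφ⟩ - Z (x₀.1 ⟨φ, hNN' hφ⟩) = Y.ρ φ t - t := by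
  intro φ hφ Z hS x₁ x₀ hx₁ hx₀
  have hφw : w⁻¹ * φ * w ∈ N := by
    have h' := ‹N.Normal›.conj_mem φ hφ w⁻¹
    rwa [inv_inv] at h'
  obtain ⟨t, ht⟩ := h (w⁻¹ * φ * w) hφw _ (hSconj φ Z w hS)
    (contOneCocycles.pullback (subgroupConj N w⁻¹) (conjRepHom Y N w⁻¹) x₁)
    (contOneCocycles.pullback (subgroupConj N' w⁻¹) (conjRepHom Y N' w⁻¹) x₀)
    (oneCocycleClass_conj_inv_eq Y w ξ₁ x₁ hx₁) (oneCocycleClass_conj_inv_eq Y w ξ₀ x₀ hx₀)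
  rw [conj_inv_pullback_apply_conj Y w φ hφ hφw x₁,
    conj_inv_pullback_apply_conj Y w φ (hNN' hφ) (hNN' hφw) x₀] at ht
  simp only [LinearMap.coe_comp, Function.comp_apply, ContinuousLinearMap.coe_coe,
    ρ_apply_ρ_inv_apply, ← map_sub] at ht
  refine ⟨Y.ρ w t, ?_⟩
  have h' := congrArg (Y.ρ w) ht
  rwa [ρ_apply_ρ_inv_apply, rho_apply_rho_conj_sub] at h'

omit [N.Normal] [N'.Normal] in
/-- **`CONG_S` is additive**: from the pairs `(ξ₁, ξ₀)` and `(ξ₁', ξ₀')` to `(ξ₁ + ξ₁', ξ₀ + ξ₀')`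
(a representative of a sum minus a representative of one summand represents the other). [folklore] -/
theorem cong_add (ξ₁ ξ₁' : continuousCohomology 1 (subgroupRep Y N))
    (ξ₀ ξ₀' : continuousCohomology 1 (subgroupRep Y N'))
    (h : ∀ (φ : G) (hφ : φ ∈ N) (Z : Y →ₗ[R] Y), S φ Z →
      ∀ (x₁ : contOneCocycles (subgroupRep Y N)) (x₀ : contOneCocycles (subgroupRep Y N')),
        oneCocycleClass _ x₁ = ξ₁ → oneCocycleClass _ x₀ = ξ₀ →
          ∃ t : Y, x₁.1 ⟨φ, hφ⟩ - Z (x₀.1 ⟨φ, hNN' hφ⟩) = Y.ρ φ t - t)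
    (h' : ∀ (φ : G) (hφ : φ ∈ N) (Z : Y →ₗ[R] Y), S φ Z →
      ∀ (x₁ : contOneCocycles (subgroupRep Y N)) (x₀ : contOneCocycles (subgroupRep Y N')),
        oneCocycleClass _ x₁ = ξ₁' → oneCocycleClass _ x₀ = ξ₀' →
          ∃ t : Y, x₁.1 ⟨φ, hφ⟩ - Z (x₀.1 ⟨φ, hNN' hφ⟩) = Y.ρ φ t - t) :
    ∀ (φ : G) (hφ : φ ∈ N) (Z : Y →ₗ[R] Y), S φ Z →
      ∀ (x₁ : contOneCocycles (subgroupRep Y N)) (x₀ : contOneCocycles (subgroupRep Y N')),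
        oneCocycleClass _ x₁ = ξ₁ + ξ₁' → oneCocycleClass _ x₀ = ξ₀ + ξ₀' →
          ∃ t : Y, x₁.1 ⟨φ, hφ⟩ - Z (x₀.1 ⟨φ, hNN' hφ⟩) = Y.ρ φ t - t := by
  intro φ hφ Z hS x₁ x₀ hx₁ hx₀
  obtain ⟨a₁, ha₁⟩ := oneCocycleClass_surjective _ ξ₁
  obtain ⟨a₀, ha₀⟩ := oneCocycleClass_surjective _ ξ₀
  have hb₁ : oneCocycleClass _ (x₁ - a₁) = ξ₁' := by
    rw [oneCocycleClass_sub, hx₁, ha₁, add_sub_cancel_left]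
  have hb₀ : oneCocycleClass _ (x₀ - a₀) = ξ₀' := by
    rw [oneCocycleClass_sub, hx₀, ha₀, add_sub_cancel_left]
  obtain ⟨t, ht⟩ := h φ hφ Z hS a₁ a₀ ha₁ ha₀
  obtain ⟨t', ht'⟩ := h' φ hφ Z hS (x₁ - a₁) (x₀ - a₀) hb₁ hb₀
  refine ⟨t + t', ?_⟩
  simp only [Submodule.coe_sub, ContinuousMap.sub_apply, map_sub] at ht'
  rw [map_add]
  linear_combination (norm := abel) ht + ht'

omit [N.Normal] [N'.Normal] in
/-- **`CONG_S(0, 0)`**: representatives of `0` are coboundaries `∂v`, `∂v'`, and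
`(φ−1)v − Z(φ−1)v' = (φ−1)(v − Zv')` as `Z` commutes with `ρ(φ)` on `S`. [folklore] -/
theorem cong_zero (hSZ : ∀ φ (Z : Y →ₗ[R] Y), S φ Z → ∀ t : Y, Z (Y.ρ φ t) = Y.ρ φ (Z t)) :
    ∀ (φ : G) (hφ : φ ∈ N) (Z : Y →ₗ[R] Y), S φ Z →
      ∀ (x₁ : contOneCocycles (subgroupRep Y N)) (x₀ : contOneCocycles (subgroupRep Y N')),
        oneCocycleClass _ x₁ = 0 → oneCocycleClass _ x₀ = 0 →
          ∃ t : Y, x₁.1 ⟨φ, hφ⟩ - Z (x₀.1 ⟨φ, hNN' hφ⟩) = Y.ρ φ t - t := by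
  intro φ hφ Z hS x₁ x₀ hx₁ hx₀
  rw [oneCocycleClass_eq_zero_iff] at hx₁ hx₀
  obtain ⟨v, hv⟩ := hx₁
  obtain ⟨v', hv'⟩ := hx₀
  refine ⟨v - Z v', ?_⟩
  rw [hv, hv']
  change Y.ρ φ v - v - Z (Y.ρ φ v' - v') = Y.ρ φ (v - Z v') - (v - Z v')
  rw [map_sub Z, hSZ φ Z hS, map_sub (Y.ρ φ)]
  abel

end Cocycles

/-! ### §2 Abstract closure: relations preserved by conjugations, sums and zero are preserved by
the derivative operators and their products -/

section Abstract

variable {A : Type*} [Semiring A] {X₁ X₀ : Type*} [AddCommMonoid X₁] [Module A X₁]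
  [AddCommMonoid X₀] [Module A X₀] (C : X₁ → X₀ → Prop)

/-- Closure under `ℕ`-multiples from closure under `+` and `(0,0)`. [folklore] -/
theorem rel_nsmul (hadd : ∀ a a' b b', C a b → C a' b' → C (a + a') (b + b')) (hzero : C 0 0)
    (n : ℕ) {a : X₁} {b : X₀} (h : C a b) : C (n • a) (n • b) := by
  induction n with
  | zero => rwa [zero_smul, zero_smul]
  | succ n ih => rw [succ_nsmul, succ_nsmul]; exact hadd _ _ _ _ ih h

/-- Closure under the scalar operators `(n : Module.End)`. [folklore] -/
theorem rel_natCast_apply (hadd : ∀ a a' b b', C a b → C a' b' → C (a + a') (b + b'))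
    (hzero : C 0 0) (n : ℕ) {a : X₁} {b : X₀} (h : C a b) :
    C ((n : Module.End A X₁) a) ((n : Module.End A X₀) b) := by
  rw [Module.End.natCast_apply, Module.End.natCast_apply]
  exact rel_nsmul C hadd hzero n h

/-- Closure under finite sums. [folklore] -/
theorem rel_sum (hadd : ∀ a a' b b', C a b → C a' b' → C (a + a') (b + b')) (hzero : C 0 0)
    {ι : Type*} (s : Finset ι) (f : ι → X₁) (g : ι → X₀) (h : ∀ i ∈ s, C (f i) (g i)) :
    C (∑ i ∈ s, f i) (∑ i ∈ s, g i) := by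
  classical
  induction s using Finset.induction_on with
  | empty => rwa [sum_empty, sum_empty]
  | insert i s hi ih =>
    rw [sum_insert hi, sum_insert hi]
    exact hadd _ _ _ _ (h i (mem_insert_self i s)) (ih fun j hj => h j (mem_insert_of_mem hj))

/-- Closure under the powers of a pair of compatible operators. [folklore] -/
theorem rel_pow_apply (E : Module.End A X₁) (E' : Module.End A X₀)
    (hE : ∀ a b, C a b → C (E a) (E' b)) (j : ℕ) {a : X₁} {b : X₀} (h : C a b) :
    C ((E ^ j) a) ((E' ^ j) b) := by
  induction j generalizing a b with
  | zero => rwa [pow_zero, pow_zero, Module.End.one_apply, Module.End.one_apply]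
  | succ j ih => rw [pow_succ, pow_succ, Module.End.mul_apply, Module.End.mul_apply]; exact ih (hE _ _ h)

/-- **Closure under the derivative operators `D = Σ_{j<M} j E^j`.** [folklore] -/
theorem rel_deriv_apply (hadd : ∀ a a' b b', C a b → C a' b' → C (a + a') (b + b'))
    (hzero : C 0 0) (E : Module.End A X₁) (E' : Module.End A X₀)
    (hE : ∀ a b, C a b → C (E a) (E' b)) (M : ℕ) {a : X₁} {b : X₀} (h : C a b) :
    C ((∑ j ∈ range M, (j : Module.End A X₁) * E ^ j) a)
      ((∑ j ∈ range M, (j : Module.End A X₀) * E' ^ j) b) := by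
  rw [LinearMap.sum_apply, LinearMap.sum_apply]
  refine rel_sum C hadd hzero (range M) _ _ fun j _ => ?_
  rw [Module.End.mul_apply, Module.End.mul_apply]
  exact rel_natCast_apply C hadd hzero j (rel_pow_apply C E E' hE j h)

/-- **Closure under `D_r = ∏_{ℓ ∈ r} D_ℓ`** (`Finset.noncommProd`, for any commutation proofs):
if `C` is preserved by each pair `(E ℓ, E' ℓ)` of operators, by sums and by `(0, 0)`, then it is
preserved by `(r.noncommProd (ℓ ↦ Σ_{j<N ℓ} j (E ℓ)^j), r.noncommProd (ℓ ↦ Σ_{j<N ℓ} j (E' ℓ)^j))`.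
[folklore] -/
theorem rel_noncommProd_deriv (hadd : ∀ a a' b b', C a b → C a' b' → C (a + a') (b + b'))
    (hzero : C 0 0) {κ : Type*} (E : κ → Module.End A X₁) (E' : κ → Module.End A X₀)
    (hE : ∀ ℓ a b, C a b → C (E ℓ a) (E' ℓ b)) (Nℓ : κ → ℕ) (r : Finset κ)
    (comm : (r : Set κ).Pairwise fun a b =>
      Commute (∑ j ∈ range (Nℓ a), (j : Module.End A X₁) * E a ^ j)
        (∑ j ∈ range (Nℓ b), (j : Module.End A X₁) * E b ^ j))
    (comm' : (r : Set κ).Pairwise fun a b =>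
      Commute (∑ j ∈ range (Nℓ a), (j : Module.End A X₀) * E' a ^ j)
        (∑ j ∈ range (Nℓ b), (j : Module.End A X₀) * E' b ^ j))
    {a : X₁} {b : X₀} (h : C a b) :
    C (r.noncommProd (fun ℓ => ∑ j ∈ range (Nℓ ℓ), (j : Module.End A X₁) * E ℓ ^ j) comm a)
      (r.noncommProd (fun ℓ => ∑ j ∈ range (Nℓ ℓ), (j : Module.End A X₀) * E' ℓ ^ j) comm' b) := by
  classical
  induction r using Finset.induction_on generalizing a b with
  | empty => simpa only [noncommProd_empty, Module.End.one_apply] using h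
  | insert ℓ s hℓ ih =>
    rw [noncommProd_insert_of_notMem _ _ _ _ hℓ, noncommProd_insert_of_notMem _ _ _ _ hℓ,
      Module.End.mul_apply, Module.End.mul_apply]
    exact rel_deriv_apply C hadd hzero (E ℓ) (E' ℓ) (hE ℓ) (Nℓ ℓ)
      (ih (comm.mono fun _ hx => mem_insert_of_mem hx) (comm'.mono fun _ hx => mem_insert_of_mem hx) h)

end Abstract

/-! ### §3 `CONG_S(c_{rq}, c_r) ⇒ CONG_S(D_r c_{rq}, D_r c_r)` -/

section Deriv

variable {R : Type v} [CommRing R] [TopologicalSpace R]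
variable {G : Type u} [Group G] [TopologicalSpace G] [IsTopologicalGroup G]
variable (Y : TopRep.{u} R G) (N N' : Subgroup G) [N.Normal] [N'.Normal] (hNN' : N ≤ N')
variable (S : G → (Y →ₗ[R] Y) → Prop)

/-- **The Kolyvagin congruence passes from `(c_{rq}, c_r)` to `(D_r c_{rq}, D_r c_r)`**
([PerrinRiou98] Prop. 2.2.5 (ii) at all `λ ∣ l`, transported through [Rubin00] Def. 4.4.1):
for a conjugation-stable family `S` of data `(φ, Z)` with `Z` commuting with `ρ(φ)`, the property
`CONG_S` (all `(φ, Z) ∈ S`, `φ ∈ N`, all representatives: `x₁(φ) − Z x₀(φ) ∈ (φ−1)Y`) of a pair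
`(ξ₁, ξ₀) ∈ H¹(N, Y) × H¹(N', Y)` implies `CONG_S` of
`(r.noncommProd (D on H¹(N, Y)) ξ₁, r.noncommProd (D on H¹(N', Y)) ξ₀)` for the derivative
operators `D_ℓ = Σ_{j<N_ℓ} j (σ_ℓ^j ·)` built from the SAME `σ_ℓ` on both sides (any commutation
proofs `comm`, `comm'`). [cite: PerrinRiou1998AIF, Prop. 2.2.5 (ii)] [cite: Rubin2000, Def. 4.4.1] -/
theorem cong_noncommProd_deriv
    (hSconj : ∀ φ (Z : Y →ₗ[R] Y) (w : G), S φ Z →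
      S (w⁻¹ * φ * w) (((Y.ρ w⁻¹ : Y →L[R] Y) : Y →ₗ[R] Y) ∘ₗ Z ∘ₗ ((Y.ρ w : Y →L[R] Y) : Y →ₗ[R] Y)))
    (hSZ : ∀ φ (Z : Y →ₗ[R] Y), S φ Z → ∀ t : Y, Z (Y.ρ φ t) = Y.ρ φ (Z t))
    {κ : Type*} (σ : κ → G) (Nℓ : κ → ℕ) (r : Finset κ) (comm) (comm')
    (ξ₁ : continuousCohomology 1 (subgroupRep Y N)) (ξ₀ : continuousCohomology 1 (subgroupRep Y N'))
    (h : ∀ (φ : G) (hφ : φ ∈ N) (Z : Y →ₗ[R] Y), S φ Z →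
      ∀ (x₁ : contOneCocycles (subgroupRep Y N)) (x₀ : contOneCocycles (subgroupRep Y N')),
        oneCocycleClass _ x₁ = ξ₁ → oneCocycleClass _ x₀ = ξ₀ →
          ∃ t : Y, x₁.1 ⟨φ, hφ⟩ - Z (x₀.1 ⟨φ, hNN' hφ⟩) = Y.ρ φ t - t) :
    ∀ (φ : G) (hφ : φ ∈ N) (Z : Y →ₗ[R] Y), S φ Z →
      ∀ (x₁ : contOneCocycles (subgroupRep Y N)) (x₀ : contOneCocycles (subgroupRep Y N')),
        oneCocycleClass _ x₁ = (r.noncommProd (fun ℓ => ∑ j ∈ range (Nℓ ℓ),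
            (j : Module.End R (continuousCohomology 1 (subgroupRep Y N))) *
              (conjMap Y N (σ ℓ) 1).hom.toLinearMap ^ j) comm) ξ₁ →
        oneCocycleClass _ x₀ = (r.noncommProd (fun ℓ => ∑ j ∈ range (Nℓ ℓ),
            (j : Module.End R (continuousCohomology 1 (subgroupRep Y N'))) *
              (conjMap Y N' (σ ℓ) 1).hom.toLinearMap ^ j) comm') ξ₀ →
          ∃ t : Y, x₁.1 ⟨φ, hφ⟩ - Z (x₀.1 ⟨φ, hNN' hφ⟩) = Y.ρ φ t - t := by
  -- the relation `C = CONG_S` and its closure properties (§1)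
  refine rel_noncommProd_deriv
    (fun (a : continuousCohomology 1 (subgroupRep Y N)) (b : continuousCohomology 1 (subgroupRep Y N')) =>
      ∀ (φ : G) (hφ : φ ∈ N) (Z : Y →ₗ[R] Y), S φ Z →
        ∀ (x₁ : contOneCocycles (subgroupRep Y N)) (x₀ : contOneCocycles (subgroupRep Y N')),
          oneCocycleClass _ x₁ = a → oneCocycleClass _ x₀ = b →
            ∃ t : Y, x₁.1 ⟨φ, hφ⟩ - Z (x₀.1 ⟨φ, hNN' hφ⟩) = Y.ρ φ t - t)
    (fun a a' b b' ha hb => cong_add Y N N' hNN' S a a' b b' ha hb) (cong_zero Y N N' hNN' S hSZ)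
    (fun ℓ => (conjMap Y N (σ ℓ) 1).hom.toLinearMap) (fun ℓ => (conjMap Y N' (σ ℓ) 1).hom.toLinearMap)
    (fun ℓ a b hab => ?_) Nℓ r comm comm' h
  exact cong_conjMap Y N N' hNN' S hSconj a b hab (σ ℓ)

end Deriv

end Congruence

end Summit.BirchSwinnertonDyer.Rank1Residual.GaloisImage

end
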